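import Summits.QuantumFields.YangMills.Theorems.BalabanUVNodesN14StubTwoTextVOptShellOfUndressedClassLawTVAndBinderK3V6
import Summits.QuantumFields.YangMills.Theorems.BalabanUVNodesN19RekeyingCalculus
import Summits.QuantumFields.YangMills.Theorems.BalabanUVNodesSpineCanonicalWeights

/-!
# BalabanUVNodes ∕ N20·N21·N19′ — module 13U: ANY PER-TUPLE HYBRID CERTIFICATE AT THE RECORD's CARRIERS TYPES INTO K3⁸'s STUB 2 AT `(jc, sh) := (0, ITS OWN SHELLS)` —
# from «at every guarded admissible Stage-13 tuple and every `(g₀, os)`, SOME shells `shA, shB`, budget `Wsh` and rate `δ` with `HybridNE7 1 (F.side⁴) (classSet₁₃ θ 0 g₀)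
# (weightA₁₃ …) (weightB₁₃ …) ∅ 0 shA shB Wsh δ`» (node U5's hybrid binder list with NO bad class — the output shape of dag-n20-w4's class-law road p609004 and of dag-n20-w5's
# three Hellinger-road capstones) the four slot-free ∕ (B)-free conjuncts `PinnedAtLive ∧ KeyedRelWeight ∧ KeyedShellWeight ∧ KeyedCoreEdgeHolderD4BFree` of
# `stub_expansion13HV`'s conclusion hold at the reading of record pinned EVERYWHERE with the certificate's shells chosen per tuple; with the keyed live line (N27x) the
# REGISTERED v6 TEXT follows, and K3⁸ BY NAME modulo stub 1's text; any bad class folds in first (dag-n19-w1's `hybridNE7_foldBad`)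

Cell `pub-ymgap` (HUMAN RULING D-0062 Track A; D-0149 width push), seat `pub-ymgap-dag-n20-w3` (WIDTH SEAT 3 of 3 on NODE n20 = NE7b) gen 8, CLAIM-3 ∕ INTENT-3
(pub-ymgap INBOX).  Filed `--kind proof --supports stmt-QuantumFields-27366 --as helper` (K3⁸ `SpineGivenEndpointR13SepCoPHV`, skeleton v6 b4e55110ab73e679; dag-lead KEY MAP v2).
COUNT-NEUTRAL.  ADDITIVE — imports dag-n14-w2's FILE 9 `…N14StubTwoTextVOptShellOfUndressedClassLawTVAndBinderK3V6` (p630195 lineage: `keyedExtractionBFree_crOfRecord₁₃V_of_liveLine`;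
through it dag-n27-w1's mirrors `K3V5Defs` ∕ `K3V6Defs`, this lineage's 13b ∕ 13R (`pinnedAtLive_crOfRecord₁₃V`, `relWeightBound_crOfRecord₁₃VAt_cutZero`), dag-n20-d's reading of record
`crOfRecord₁₃V` with its transfers `shellWeightBound_∕core_crOfRecord₁₃VAt`), dag-n19-w1's `…N19RekeyingCalculus` (p601591: `hybridNE7_foldBad`) and dag-n20-d's
`…SpineCanonicalWeights` (`core_nonneg_of_shellWeightBound`); modifies nothing.  Inside the theses cone (via `K3V5Defs`) like 13b ∕ 13R ∕ 13T.
[LF-II] = [Balaban1989LargeFieldII], [King1986] = CMP 102 (locations only).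

WHY.  Every positive road of the N19′∕N20∕N21 width lanes ends in node U5's binder list at ABSTRACT carriers with NO bad class: dag-n20-w4's `exists_hybridNE7_of_target_of_classLawTV`
(p609004), dag-n20-w5's `exists_hybridNE7_of_endpointLetters` ∕ `…_of_variance_and_response` ∕ `…_of_refreshProcesses_tameTilts_and_response` (p621561∕p623765 lineage) all conclude
`∃ shA shB, HybridNE7 l₀ vol T A B (fun _ _ ↦ ∅) (fun _ ↦ 0) shA shB Wsh δ`; dag-n20-w5's HANDOFFs (g3∕g4∕g5 (t2)∕(t3)(b)) leave «the typing of `(∅, 0, shA, shB)` into stub 2's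
`(jc := 0, sh)`» to this lineage.  Module 13R typed it for ONE certificate (the ℓ¹-optimal shells, `δ = 0`); dag-n14-w2's FILE 9 for the class-law-TV letter through those shells.
THIS FILE types it for ANY certificate, using the certificate's OWN shells:
* §1 ★★ `exists_pinnedFaces_of_keyedHybridNE7NoBad` — from the keyed no-bad-class certificate `hH`, a shell split `sh : ShellSplit₁₃CoPH 2 0` (classical CHOICE of the certificate's
  shells at guarded admissible tuples, zero shells elsewhere) such that `cr⋆ := crOfRecord₁₃V (fun _ ↦ 0) sh` carries `PinnedAtLive 0 sh cr⋆` (`rfl`), `KeyedRelWeight cr⋆` (cut `0`: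
  free, dag-n20-w2 p590852 through 13b), `KeyedShellWeight cr⋆` (the certificate's `shell` field, dag-n20-d's `shellWeightBound_crOfRecord₁₃VAt` — canonical `Wsh` below any
  witness), and `KeyedCoreEdgeHolderD4BFree β cr⋆ rr` for EVERY `β`, `rr` (the certificate's `core` + `summable` fields through `core_crOfRecord₁₃VAt`, bad class `badClass₁₃ … 0 = ∅`
  by dag-n20-w2's `badClass₁₃_cutZero`, non-negative cores from the `shell` field; `PHolderD4` UNREAD under `ForSmallCouplings.of_forall`); ★ `exists_pinnedFaces_of_keyedHybridNE7`
  — ANY bad class `Bad`, weight `W`: fold first (`hybridNE7_foldBad`: `Bad ↦ ∅`, `W ↦ 0`, shells absorb the bad terms, `Wsh ↦ W + Wsh`).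
* §2 ★★★ `stubExpansion13HVText_of_keyedHybridNE7NoBad_of_keyedExtraction` — the REGISTERED v6 TEXT of `stub_expansion13HV` (verbatim over `K3V6Defs`, as in
  `spineGivenEndpointR13SepCoPHV_of_stubTextsV`) from `hH` plus the (B)-free extraction face at every zero-cut pinned reading (`∀ sh, KeyedExtractionBFree (crOfRecord₁₃V 0 sh)`; the
  rates hypothesis and the N16 guard UNREAD); ★★★ `…_of_liveLine` — the extraction face supplied by dag-n14-w2's keyed live line `LiveSel ∧ ZetaMeasurable`; ★★
  `spineGivenEndpointR13SepCoPHV_of_stubRates13HVText_of_keyedHybridNE7NoBad_of_liveLine` — ⊢ the item `Theses.BalabanUVNodes.SpineGivenEndpointR13SepCoPHV` BY NAME modulo stub 1's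
  v6 text; the any-`Bad` twins.
LOCATED (said, not decided): at v6 the K5 content of stub 2 at the record is EXACTLY «a no-bad-class hybrid certificate per guarded admissible tuple and `(g₀, os)`» + N27x on the live
line — the `∃ (jc, sh)` of the text is served by `(0, the certificate's shells)`, whatever road produced the certificate; 13R (optimal shells), dag-n14-w2 FILE 9 (TV letter) and
dag-n20-w5's capstones (affinity ∕ variance ∕ refresh letters, once keyed per tuple) are instances.  Conversely 13T ∕ p610536: the texts force law merge, so no certificate exists
under (LS).

HONEST FRAMING.  By-name plumbing + classical choice over the tree's SHAPES; proves NO estimate; `hH` (a hybrid certificate at EVERY guarded admissible tuple — the two-run content,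
NOT PRINTED for `d = 4`), the live line and stub 1's text are HYPOTHESES inhabited for no tuple (K0⁷ `Record13SepCoPHInhabited` OPEN); NOT a proof of `stub_expansion13HV` nor of
K3⁸; nothing of Bałaban's asserted; NE7 ∕ NE7b ∕ NE7c NOT PROVED; N19 ∕ N20 ∕ N21 ∕ N27x NOT discharged; K3⁸ OPEN, v6 STANDS, not claimed; counts unmoved; no count claim.  One
finite `𝕋⁴_{L^K}` programme at fixed `ε`, Bałaban AS PRINTED — R4 closes the conditional finite-𝕋⁴ rung `BalabanLadder.UV` only; the YM mass gap (Clay) is NOT proved by any of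
this; NOT ℝ⁴, NOT continuum, NOT OS.  No `def`, no `instance`, no `notation`, no `sorry`.  Sources (location only): [LF-II] Thm 1 + (0.1) pp.355–356; [King1986] (3.10)–(3.13) pp.656–657.
-/

noncomputable section

open Finset
open scoped BigOperators

namespace Summit.QuantumFields.YangMills.BalabanUVNodes.N20StubTwoTextVOfKeyedHybridCertificate

open Literature.MathematicalPhysics.QuantumFieldTheory.Balaban1983to89
open Literature.MathematicalPhysics.QuantumFieldTheory.Balaban1983to89.T4Continuum
open Literature.MathematicalPhysics.QuantumFieldTheory.Balaban1983to89.Node00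
open T4ContinuumYM4Torus (ForSmallCouplings)
open T4MatchingAssembly (HybridNE7)
open Summit.QuantumFields.BalabanUV.T4Continuum.Spine
open YMDAG.UVSplit hiding SU
open Summit.QuantumFields.YangMills.Theorems.K3V5Defs (SpineReading RateReadingFn RunSel LetterReading CutReading rrOfRecord GuardedReadingN16
  KeyedRelWeight KeyedShellWeight LiveSel PinnedAtLive)
open Summit.QuantumFields.YangMills.Theorems.K3V6Defs (KeyedRatesHolderD4V KeyedCoreEdgeHolderD4V KeyedCoreEdgeHolderD4BFree KeyedExtractionV KeyedExtractionBFree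
  keyedCoreEdgeHolderD4V_of_bFree keyedExtractionV_of_bFree spineGivenEndpointR13SepCoPHV_of_stubTextsV)
open Summit.QuantumFields.YangMills.BalabanUVNodes.N20CoreEdgeShellDial (relWeightBound_crOfRecord₁₃VAt_cutZero pinnedAtLive_crOfRecord₁₃V)
open Summit.QuantumFields.YangMills.BalabanUVNodes.N20KeyedRelWeightCutZero (badClass₁₃_cutZero)
open Summit.QuantumFields.YangMills.BalabanUVNodes.SpineCanonicalWeights (core_nonneg_of_shellWeightBound)
open Summit.QuantumFields.YangMills.BalabanUVNodes.N19RekeyingCalculus (hybridNE7_foldBad)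
open YMDAG.N14.StubTwoTextVOfUndressedClassLawTVAndBinder (keyedExtractionBFree_crOfRecord₁₃V_of_liveLine)

variable {F : T4Family}

/-! ## §1 The certificate's own shells, chosen per tuple, serve the four slot-free ∕ (B)-free conjuncts at the zero cut -/

section Faces

/-- **★★ ANY KEYED NO-BAD-CLASS HYBRID CERTIFICATE SERVES THE FOUR SLOT-FREE ∕ (B)-FREE CONJUNCTS OF STUB 2 AT `(0, its own shells)`.**  Hypothesis `hH`: at every Stage-13 tuple
`(F, θ, hP)` passing the guard `ZhUnity ∧ SlotsNondegenerate₁₃` and `Admissible`, for every `(g₀, os)`, SOME `shA shB Wsh δ` with node U5's binder list `HybridNE7 1 (F.side ^ 4)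
(classSet₁₃ θ 0 g₀) (weightA₁₃ θ hP 0 g₀ os) (weightB₁₃ θ hP 0 g₀ os) ∅ 0 shA shB Wsh δ`.  Conclusion: a shell split `sh` (choice of those shells at guarded admissible tuples, `0`
elsewhere) with, at `cr⋆ := crOfRecord₁₃V (fun _ ↦ 0) sh`: the pin (`rfl`), N20 (free at cut `0`), N21 (the certificate's shell face; the reading's canonical `Wsh` lies below any
witness), and N19′'s (B)-free face for EVERY exponent `β` and rate reading `rr` (its `core` + `summable` fields; `PHolderD4` unread).  `hH` is the two-run CONTENT — a HYPOTHESIS.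
[cite: King1986, (3.10)–(3.13) pp.656–657 (the hybrid binder list, template only)] [bookkeeping] -/
theorem exists_pinnedFaces_of_keyedHybridNE7NoBad
    (hH : ∀ (F : T4Family) (θ : Stage13HParams F 2) (hP : θ.Provisos₁₃CoPH F 2), (θ.ZhUnity F 2 ∧ θ.SlotsNondegenerate₁₃ F 2) → θ.Admissible F 2 →
      ∀ (g₀ : ℕ → ℝ) (os : List (ULoop F)),
        letI : DecidableEq (Σ K, SiteSeqKey F (0 + K)) := Classical.decEq _
        ∃ (shA shB : ℕ → ℝ → (Σ K, SiteSeqKey F (0 + K)) → ℝ) (Wsh δ : ℕ → ℝ),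
          HybridNE7 1 (F.side ^ 4) (classSet₁₃ θ 0 g₀) (weightA₁₃ θ hP 0 g₀ os) (weightB₁₃ θ hP 0 g₀ os) (fun _ _ => ∅) (fun _ => 0) shA shB Wsh δ) :
    ∃ sh : ShellSplit₁₃CoPH 2 0,
      PinnedAtLive (fun _ _ _ _ _ _ => 0) sh (fun F θ hP g₀ os => crOfRecord₁₃V (fun _ => 0) sh F θ hP g₀ os) ∧
      KeyedRelWeight (fun F θ hP g₀ os => crOfRecord₁₃V (fun _ => 0) sh F θ hP g₀ os) ∧
      KeyedShellWeight (fun F θ hP g₀ os => crOfRecord₁₃V (fun _ => 0) sh F θ hP g₀ os) ∧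
      ∀ (β : ℝ) (rr : RateReadingFn), KeyedCoreEdgeHolderD4BFree β (fun F θ hP g₀ os => crOfRecord₁₃V (fun _ => 0) sh F θ hP g₀ os) rr := by
  -- the certificate's shells at guarded admissible tuples, zero shells elsewhere (classical case split on the guard, no global `classical`)
  let sh : ShellSplit₁₃CoPH 2 0 := fun F θ hP g₀ os =>
    @dite _ ((θ.ZhUnity F 2 ∧ θ.SlotsNondegenerate₁₃ F 2) ∧ θ.Admissible F 2) (Classical.dec _)
      (fun h => ((hH F θ hP h.1 h.2 g₀ os).choose, (hH F θ hP h.1 h.2 g₀ os).choose_spec.choose))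
      (fun _ => (fun _ _ _ => 0, fun _ _ _ => 0))
  have hsh : ∀ (F : T4Family) (θ : Stage13HParams F 2) (hP : θ.Provisos₁₃CoPH F 2) (hG : θ.ZhUnity F 2 ∧ θ.SlotsNondegenerate₁₃ F 2) (hθ : θ.Admissible F 2)
      (g₀ : ℕ → ℝ) (os : List (ULoop F)),
      sh F θ hP g₀ os = ((hH F θ hP hG hθ g₀ os).choose, (hH F θ hP hG hθ g₀ os).choose_spec.choose) := fun F θ hP hG hθ g₀ os =>
    dif_pos (show (θ.ZhUnity F 2 ∧ θ.SlotsNondegenerate₁₃ F 2) ∧ θ.Admissible F 2 from ⟨hG, hθ⟩)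
  -- the certificate at a guarded admissible tuple, read at `sh`'s components
  have hcert : ∀ (F : T4Family) (θ : Stage13HParams F 2) (hP : θ.Provisos₁₃CoPH F 2) (hG : θ.ZhUnity F 2 ∧ θ.SlotsNondegenerate₁₃ F 2) (hθ : θ.Admissible F 2)
      (g₀ : ℕ → ℝ) (os : List (ULoop F)),
      letI : DecidableEq (Σ K, SiteSeqKey F (0 + K)) := Classical.decEq _
      ∃ Wsh δ : ℕ → ℝ, HybridNE7 1 (F.side ^ 4) (classSet₁₃ θ 0 g₀) (weightA₁₃ θ hP 0 g₀ os) (weightB₁₃ θ hP 0 g₀ os) (fun _ _ => ∅) (fun _ => 0)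
        (sh F θ hP g₀ os).1 (sh F θ hP g₀ os).2 Wsh δ := fun F θ hP hG hθ g₀ os => by
    rw [hsh F θ hP hG hθ g₀ os]
    exact (hH F θ hP hG hθ g₀ os).choose_spec.choose_spec
  refine ⟨sh, pinnedAtLive_crOfRecord₁₃V (fun _ _ _ _ _ _ => 0) sh, fun F θ hP _ _ g₀ os => relWeightBound_crOfRecord₁₃VAt_cutZero 0 sh θ hP g₀ os, ?_, ?_⟩
  · -- N21: the certificate's shell face, transferred to the reading's canonical `Wsh`
    intro F θ hP hG hθ g₀ os
    letI : DecidableEq (Σ K, SiteSeqKey F (0 + K)) := Classical.decEq _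
    obtain ⟨Wsh, δ, hHy⟩ := hcert F θ hP hG hθ g₀ os
    exact shellWeightBound_crOfRecord₁₃VAt 0 (fun _ => 0) sh θ hP g₀ os hHy.shell
  · -- N19′ (B)-free + U4′: the certificate's core and summable fields at the empty bad class = cut `0`
    intro β rr F θ hP hG hθ
    refine ForSmallCouplings.of_forall fun g₀ os _ => ?_
    letI : DecidableEq (Σ K, SiteSeqKey F (0 + K)) := Classical.decEq _
    obtain ⟨Wsh, δ, hHy⟩ := hcert F θ hP hG hθ g₀ os
    have hbad : badClass₁₃ θ 0 g₀ (fun _ => 0) = fun _ _ => (∅ : Finset (Σ K, SiteSeqKey F (0 + K))) :=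
      funext fun K => funext fun t => badClass₁₃_cutZero F θ 0 g₀ K t
    have hP0 : ∀ (K : ℕ) (t : ℝ), |t| ≤ 1 → ∀ x ∈ classSet₁₃ θ 0 g₀ K \ badClass₁₃ θ 0 g₀ (fun _ => 0) K t,
        0 ≤ weightA₁₃ θ hP 0 g₀ os K t x - (sh F θ hP g₀ os).1 K t x := by
      rw [hbad]
      exact core_nonneg_of_shellWeightBound (Bad := fun _ _ => ∅) hHy.shell
    have hcore : NE7.Core 1 (F.side ^ 4) (classSet₁₃ θ 0 g₀) (badClass₁₃ θ 0 g₀ (fun _ => 0))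
        (fun K t x => weightA₁₃ θ hP 0 g₀ os K t x - (sh F θ hP g₀ os).1 K t x) (fun K t x => weightB₁₃ θ hP 0 g₀ os K t x - (sh F θ hP g₀ os).2 K t x) δ := by
      rw [hbad]
      exact hHy.core
    exact ⟨_, core_crOfRecord₁₃VAt 0 (fun _ => 0) sh θ hP g₀ os hP0 hcore hHy.summable⟩

/-- **★ … WITH ANY BAD CLASS**: a keyed certificate `HybridNE7 … Bad W shA shB Wsh δ` with an arbitrary bad class per tuple serves the same four conjuncts — fold the bad terms into
the shells first (dag-n19-w1's `hybridNE7_foldBad`: `Bad ↦ ∅`, `W ↦ 0`, `Wsh ↦ W + Wsh`, same `δ`). [bookkeeping] -/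
theorem exists_pinnedFaces_of_keyedHybridNE7
    (hH : ∀ (F : T4Family) (θ : Stage13HParams F 2) (hP : θ.Provisos₁₃CoPH F 2), (θ.ZhUnity F 2 ∧ θ.SlotsNondegenerate₁₃ F 2) → θ.Admissible F 2 →
      ∀ (g₀ : ℕ → ℝ) (os : List (ULoop F)),
        letI : DecidableEq (Σ K, SiteSeqKey F (0 + K)) := Classical.decEq _
        ∃ (Bad : ℕ → ℝ → Finset (Σ K, SiteSeqKey F (0 + K))) (W : ℕ → ℝ) (shA shB : ℕ → ℝ → (Σ K, SiteSeqKey F (0 + K)) → ℝ) (Wsh δ : ℕ → ℝ),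
          HybridNE7 1 (F.side ^ 4) (classSet₁₃ θ 0 g₀) (weightA₁₃ θ hP 0 g₀ os) (weightB₁₃ θ hP 0 g₀ os) Bad W shA shB Wsh δ) :
    ∃ sh : ShellSplit₁₃CoPH 2 0,
      PinnedAtLive (fun _ _ _ _ _ _ => 0) sh (fun F θ hP g₀ os => crOfRecord₁₃V (fun _ => 0) sh F θ hP g₀ os) ∧
      KeyedRelWeight (fun F θ hP g₀ os => crOfRecord₁₃V (fun _ => 0) sh F θ hP g₀ os) ∧
      KeyedShellWeight (fun F θ hP g₀ os => crOfRecord₁₃V (fun _ => 0) sh F θ hP g₀ os) ∧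
      ∀ (β : ℝ) (rr : RateReadingFn), KeyedCoreEdgeHolderD4BFree β (fun F θ hP g₀ os => crOfRecord₁₃V (fun _ => 0) sh F θ hP g₀ os) rr := by
  refine exists_pinnedFaces_of_keyedHybridNE7NoBad fun F θ hP hG hθ g₀ os => ?_
  letI : DecidableEq (Σ K, SiteSeqKey F (0 + K)) := Classical.decEq _
  obtain ⟨Bad, W, shA, shB, Wsh, δ, h⟩ := hH F θ hP hG hθ g₀ os
  exact ⟨_, _, _, _, hybridNE7_foldBad h⟩

end Faces

/-! ## §2 The registered v6 text of `stub_expansion13HV`, and K3⁸ by name modulo stub 1's text -/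

section Texts

/-- **★★★ K3⁸ v6 STUB 2's TEXT, VERBATIM, FROM A KEYED NO-BAD-CLASS HYBRID CERTIFICATE AND THE KEYED (B)-FREE EXTRACTION FACE** — witness `(jc, sh, cr) := (0, sh⋆, crOfRecord₁₃V 0 sh⋆)`
with `sh⋆` the certificate's own shells (§1); `KeyedExtractionV` from the (B)-free face at that reading (hypothesis `hx`, for every zero-cut split — E1∕E2 do not read the shells) through
the mirror's `keyedExtractionV_of_bFree`; `KeyedCoreEdgeHolderD4V` through `keyedCoreEdgeHolderD4V_of_bFree`.  The rates hypothesis `KeyedRatesHolderD4V` and the N16 guard are UNREAD.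
NOT a proof of `stub_expansion13HV`: `hH`, `hx` are HYPOTHESES. [cite: Balaban1989LargeFieldII, Thm 1 + (0.1) pp.355–356 (location only)] [bookkeeping] -/
theorem stubExpansion13HVText_of_keyedHybridNE7NoBad_of_keyedExtraction
    (hH : ∀ (F : T4Family) (θ : Stage13HParams F 2) (hP : θ.Provisos₁₃CoPH F 2), (θ.ZhUnity F 2 ∧ θ.SlotsNondegenerate₁₃ F 2) → θ.Admissible F 2 →
      ∀ (g₀ : ℕ → ℝ) (os : List (ULoop F)),
        letI : DecidableEq (Σ K, SiteSeqKey F (0 + K)) := Classical.decEq _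
        ∃ (shA shB : ℕ → ℝ → (Σ K, SiteSeqKey F (0 + K)) → ℝ) (Wsh δ : ℕ → ℝ),
          HybridNE7 1 (F.side ^ 4) (classSet₁₃ θ 0 g₀) (weightA₁₃ θ hP 0 g₀ os) (weightB₁₃ θ hP 0 g₀ os) (fun _ _ => ∅) (fun _ => 0) shA shB Wsh δ)
    (hx : ∀ sh : ShellSplit₁₃CoPH 2 0, KeyedExtractionBFree fun F θ hP g₀ os => crOfRecord₁₃V (fun _ => 0) sh F θ hP g₀ os) :
    ∀ β : ℝ, 2 / 3 < β → β < 1 →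
      ∀ (𝔯 : RateReading₁₃CoPH 2) (ksel : RunSel) (ℓ : LetterReading) (ℓ₃ : T4Family → Node00.NE3Letters₁₁) (g B : T4Family → ℝ),
        GuardedReadingN16 𝔯 ksel ℓ ℓ₃ g B → KeyedRatesHolderD4V β (rrOfRecord 𝔯 ksel) →
        ∃ (jc : CutReading) (sh : ShellSplit₁₃CoPH 2 0) (cr : SpineReading), PinnedAtLive jc sh cr ∧
          KeyedRelWeight cr ∧ KeyedShellWeight cr ∧ KeyedExtractionV cr ∧ KeyedCoreEdgeHolderD4V β cr (rrOfRecord 𝔯 ksel) := by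
  intro β _ _ 𝔯 ksel _ _ _ _ _ _
  obtain ⟨sh, hpin, h20, h21, h19⟩ := exists_pinnedFaces_of_keyedHybridNE7NoBad hH
  exact ⟨fun _ _ _ _ _ _ => 0, sh, fun F θ hP g₀ os => crOfRecord₁₃V (fun _ => 0) sh F θ hP g₀ os, hpin, h20, h21,
    keyedExtractionV_of_bFree (hx sh), keyedCoreEdgeHolderD4V_of_bFree (h19 β (rrOfRecord 𝔯 ksel))⟩

/-- **★★★ … THE EXTRACTION FACE SUPPLIED BY THE KEYED LIVE LINE** (dag-n14-w2's `keyedExtractionBFree_crOfRecord₁₃V_of_liveLine`: `LiveSel ∧ ZetaMeasurable` at every guarded admissible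
tuple — the shape a proviso edition `… ∧ LiveSel` would supply; today a HYPOTHESIS).  So: a keyed no-bad-class hybrid certificate + the keyed live line ⇒ the v6 text of stub 2.
NOT a proof of `stub_expansion13HV`. [cite: Balaban1989LargeFieldII, (0.1) p.356 (location only)] [bookkeeping] -/
theorem stubExpansion13HVText_of_keyedHybridNE7NoBad_of_liveLine
    (hH : ∀ (F : T4Family) (θ : Stage13HParams F 2) (hP : θ.Provisos₁₃CoPH F 2), (θ.ZhUnity F 2 ∧ θ.SlotsNondegenerate₁₃ F 2) → θ.Admissible F 2 →
      ∀ (g₀ : ℕ → ℝ) (os : List (ULoop F)),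
        letI : DecidableEq (Σ K, SiteSeqKey F (0 + K)) := Classical.decEq _
        ∃ (shA shB : ℕ → ℝ → (Σ K, SiteSeqKey F (0 + K)) → ℝ) (Wsh δ : ℕ → ℝ),
          HybridNE7 1 (F.side ^ 4) (classSet₁₃ θ 0 g₀) (weightA₁₃ θ hP 0 g₀ os) (weightB₁₃ θ hP 0 g₀ os) (fun _ _ => ∅) (fun _ => 0) shA shB Wsh δ)
    (hlive : ∀ (F : T4Family) (θ : Stage13HParams F 2), θ.Provisos₁₃CoPH F 2 → (θ.ZhUnity F 2 ∧ θ.SlotsNondegenerate₁₃ F 2) → θ.Admissible F 2 →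
      LiveSel F θ ∧ ZetaMeasurable F 2 θ.ζ) :
    ∀ β : ℝ, 2 / 3 < β → β < 1 →
      ∀ (𝔯 : RateReading₁₃CoPH 2) (ksel : RunSel) (ℓ : LetterReading) (ℓ₃ : T4Family → Node00.NE3Letters₁₁) (g B : T4Family → ℝ),
        GuardedReadingN16 𝔯 ksel ℓ ℓ₃ g B → KeyedRatesHolderD4V β (rrOfRecord 𝔯 ksel) →
        ∃ (jc : CutReading) (sh : ShellSplit₁₃CoPH 2 0) (cr : SpineReading), PinnedAtLive jc sh cr ∧
          KeyedRelWeight cr ∧ KeyedShellWeight cr ∧ KeyedExtractionV cr ∧ KeyedCoreEdgeHolderD4V β cr (rrOfRecord 𝔯 ksel) :=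
  stubExpansion13HVText_of_keyedHybridNE7NoBad_of_keyedExtraction hH fun sh =>
    keyedExtractionBFree_crOfRecord₁₃V_of_liveLine (fun _ _ _ _ _ _ => 0) sh hlive

/-- **★★ K3⁸ BY NAME MODULO STUB 1's v6 TEXT**: stub 1's registered v6 text + a keyed no-bad-class hybrid certificate + the keyed live line ⇒ `Theses.BalabanUVNodes.SpineGivenEndpointR13SepCoPHV`
(the mirror's `spineGivenEndpointR13SepCoPHV_of_stubTextsV`).  NOT a proof of K3⁸: all three inputs are HYPOTHESES inhabited for no tuple. [bookkeeping] -/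
theorem spineGivenEndpointR13SepCoPHV_of_stubRates13HVText_of_keyedHybridNE7NoBad_of_liveLine
    (h₁ : ∃ β : ℝ, 2 / 3 < β ∧ β < 1 ∧
      ∃ (𝔯 : RateReading₁₃CoPH 2) (ksel : RunSel) (ℓ : LetterReading) (ℓ₃ : T4Family → Node00.NE3Letters₁₁) (g B : T4Family → ℝ),
        GuardedReadingN16 𝔯 ksel ℓ ℓ₃ g B ∧ KeyedRatesHolderD4V β (rrOfRecord 𝔯 ksel))
    (hH : ∀ (F : T4Family) (θ : Stage13HParams F 2) (hP : θ.Provisos₁₃CoPH F 2), (θ.ZhUnity F 2 ∧ θ.SlotsNondegenerate₁₃ F 2) → θ.Admissible F 2 →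
      ∀ (g₀ : ℕ → ℝ) (os : List (ULoop F)),
        letI : DecidableEq (Σ K, SiteSeqKey F (0 + K)) := Classical.decEq _
        ∃ (shA shB : ℕ → ℝ → (Σ K, SiteSeqKey F (0 + K)) → ℝ) (Wsh δ : ℕ → ℝ),
          HybridNE7 1 (F.side ^ 4) (classSet₁₃ θ 0 g₀) (weightA₁₃ θ hP 0 g₀ os) (weightB₁₃ θ hP 0 g₀ os) (fun _ _ => ∅) (fun _ => 0) shA shB Wsh δ)
    (hlive : ∀ (F : T4Family) (θ : Stage13HParams F 2), θ.Provisos₁₃CoPH F 2 → (θ.ZhUnity F 2 ∧ θ.SlotsNondegenerate₁₃ F 2) → θ.Admissible F 2 →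
      LiveSel F θ ∧ ZetaMeasurable F 2 θ.ζ) :
    Summit.QuantumFields.YangMills.Theses.BalabanUVNodes.SpineGivenEndpointR13SepCoPHV :=
  spineGivenEndpointR13SepCoPHV_of_stubTextsV h₁ (stubExpansion13HVText_of_keyedHybridNE7NoBad_of_liveLine hH hlive)

/-- **★ THE ANY-BAD-CLASS TWIN OF ★★★**: a keyed hybrid certificate with an arbitrary bad class per tuple + the keyed live line ⇒ the v6 text of stub 2 (fold, then §2). [bookkeeping] -/
theorem stubExpansion13HVText_of_keyedHybridNE7_of_liveLine
    (hH : ∀ (F : T4Family) (θ : Stage13HParams F 2) (hP : θ.Provisos₁₃CoPH F 2), (θ.ZhUnity F 2 ∧ θ.SlotsNondegenerate₁₃ F 2) → θ.Admissible F 2 →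
      ∀ (g₀ : ℕ → ℝ) (os : List (ULoop F)),
        letI : DecidableEq (Σ K, SiteSeqKey F (0 + K)) := Classical.decEq _
        ∃ (Bad : ℕ → ℝ → Finset (Σ K, SiteSeqKey F (0 + K))) (W : ℕ → ℝ) (shA shB : ℕ → ℝ → (Σ K, SiteSeqKey F (0 + K)) → ℝ) (Wsh δ : ℕ → ℝ),
          HybridNE7 1 (F.side ^ 4) (classSet₁₃ θ 0 g₀) (weightA₁₃ θ hP 0 g₀ os) (weightB₁₃ θ hP 0 g₀ os) Bad W shA shB Wsh δ)
    (hlive : ∀ (F : T4Family) (θ : Stage13HParams F 2), θ.Provisos₁₃CoPH F 2 → (θ.ZhUnity F 2 ∧ θ.SlotsNondegenerate₁₃ F 2) → θ.Admissible F 2 →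
      LiveSel F θ ∧ ZetaMeasurable F 2 θ.ζ) :
    ∀ β : ℝ, 2 / 3 < β → β < 1 →
      ∀ (𝔯 : RateReading₁₃CoPH 2) (ksel : RunSel) (ℓ : LetterReading) (ℓ₃ : T4Family → Node00.NE3Letters₁₁) (g B : T4Family → ℝ),
        GuardedReadingN16 𝔯 ksel ℓ ℓ₃ g B → KeyedRatesHolderD4V β (rrOfRecord 𝔯 ksel) →
        ∃ (jc : CutReading) (sh : ShellSplit₁₃CoPH 2 0) (cr : SpineReading), PinnedAtLive jc sh cr ∧
          KeyedRelWeight cr ∧ KeyedShellWeight cr ∧ KeyedExtractionV cr ∧ KeyedCoreEdgeHolderD4V β cr (rrOfRecord 𝔯 ksel) := by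
  refine stubExpansion13HVText_of_keyedHybridNE7NoBad_of_liveLine (fun F θ hP hG hθ g₀ os => ?_) hlive
  letI : DecidableEq (Σ K, SiteSeqKey F (0 + K)) := Classical.decEq _
  obtain ⟨Bad, W, shA, shB, Wsh, δ, h⟩ := hH F θ hP hG hθ g₀ os
  exact ⟨_, _, _, _, hybridNE7_foldBad h⟩

/-- **★ K3⁸ BY NAME MODULO STUB 1's v6 TEXT, ANY BAD CLASS.** [bookkeeping] -/
theorem spineGivenEndpointR13SepCoPHV_of_stubRates13HVText_of_keyedHybridNE7_of_liveLine
    (h₁ : ∃ β : ℝ, 2 / 3 < β ∧ β < 1 ∧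
      ∃ (𝔯 : RateReading₁₃CoPH 2) (ksel : RunSel) (ℓ : LetterReading) (ℓ₃ : T4Family → Node00.NE3Letters₁₁) (g B : T4Family → ℝ),
        GuardedReadingN16 𝔯 ksel ℓ ℓ₃ g B ∧ KeyedRatesHolderD4V β (rrOfRecord 𝔯 ksel))
    (hH : ∀ (F : T4Family) (θ : Stage13HParams F 2) (hP : θ.Provisos₁₃CoPH F 2), (θ.ZhUnity F 2 ∧ θ.SlotsNondegenerate₁₃ F 2) → θ.Admissible F 2 →
      ∀ (g₀ : ℕ → ℝ) (os : List (ULoop F)),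
        letI : DecidableEq (Σ K, SiteSeqKey F (0 + K)) := Classical.decEq _
        ∃ (Bad : ℕ → ℝ → Finset (Σ K, SiteSeqKey F (0 + K))) (W : ℕ → ℝ) (shA shB : ℕ → ℝ → (Σ K, SiteSeqKey F (0 + K)) → ℝ) (Wsh δ : ℕ → ℝ),
          HybridNE7 1 (F.side ^ 4) (classSet₁₃ θ 0 g₀) (weightA₁₃ θ hP 0 g₀ os) (weightB₁₃ θ hP 0 g₀ os) Bad W shA shB Wsh δ)
    (hlive : ∀ (F : T4Family) (θ : Stage13HParams F 2), θ.Provisos₁₃CoPH F 2 → (θ.ZhUnity F 2 ∧ θ.SlotsNondegenerate₁₃ F 2) → θ.Admissible F 2 →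
      LiveSel F θ ∧ ZetaMeasurable F 2 θ.ζ) :
    Summit.QuantumFields.YangMills.Theses.BalabanUVNodes.SpineGivenEndpointR13SepCoPHV :=
  spineGivenEndpointR13SepCoPHV_of_stubTextsV h₁ (stubExpansion13HVText_of_keyedHybridNE7_of_liveLine hH hlive)

end Texts

end Summit.QuantumFields.YangMills.BalabanUVNodes.N20StubTwoTextVOfKeyedHybridCertificate

end
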